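import Summits.QuantumFields.YangMills.Theorems.FemtoTransferGapRungW1upProfiles

/-!
# Femto transfer gap — rung W1-up, part 6/7: the trial states and the kernel lower bound

Support module of the `FemtoTransferGap` group (cell `ym-beyond`, seat P1; route `LuscherReduction`, crux `OneSiteLevels` =
`stmt-QuantumFields-20007`), part 6/7 of the sorry-free proof of the registered BC5 rung `RungUpperK1` (`stub_rungW1up`):
`∃ C B0, ∀ B ≥ B0, e^{−C λ_b(B)} λ₀(B,1) ≤ λ₁(B,1)` on the ONE-SITE lattice (`rungUpperK1` in `FemtoTransferGapRungW1up`).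

The physical product states `a = profA ⊗ profA ⊗ profA` (`stA`) and `b = profB ⊗ profA ⊗ profA` (`stB`, annulus on the link `e0`):
`a b = 0`, on their supports every link has `vacDist ≤ 3r` so the Wilson action is `≤ s0 r = 162 |P| r⁴`; the electric forms and norms
factorise (`qE_linkState`, `l2_linkState`); the TRIAL STATE `ψ = q a − p b` (`trial`) satisfies the integrated kernel bound
`⟨ψ, K_B ψ⟩ ≥ e^{−B s₀}(q² ⟨a,E a⟩ + p² ⟨b,E b⟩) − |p||q|(⟨a,E b⟩ + ⟨b,E a⟩)` (`qform_trial_ge`) and `‖ψ‖² = q²‖a‖² + p²‖b‖²`.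

## WHAT THIS IS NOT
NOT THE CLAY GAP; no statement about `L → ∞` or a continuum limit.  Everything below is proved (no `sorry`, no new axiom).
-/

set_option autoImplicit false

noncomputable section

open MeasureTheory Filter Topology Real
open scoped Matrix ComplexConjugate
open Literature.MathematicalPhysics.QuantumFieldTheory
open Literature.MathematicalPhysics.QuantumLattice

namespace Summit.QuantumFields.YangMills.Theorems.FemtoTransferGap
/-! ### D.3 The two product states -/

/-- A fixed link `e₀`. [folklore] -/
def e0 : Edge 3 1 := (0, 0)

/-- Product state with profile `h` on the link `e₀` and `g` on the others. [folklore] -/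
def linkState (g h : SU2 → ℝ) : Cfg → ℝ := fun U => ∏ e, Function.update (fun _ : Edge 3 1 => g) e0 h e (U e)

/-- The profile on link `e`. [folklore] -/
theorem update_apply_eq (g h : SU2 → ℝ) (e : Edge 3 1) :
    Function.update (fun _ : Edge 3 1 => g) e0 h e = if e = e0 then h else g := by
  by_cases he : e = e0
  · subst he; simp
  · simp [he]

/-- Product states are physical. [folklore] -/
theorem isPhys_linkState {g h : SU2 → ℝ} (hgc : Continuous g) (hhc : Continuous h) (hg0 : ∀ W, 0 ≤ g W) (hg1 : ∀ W, g W ≤ 1)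
    (hh0 : ∀ W, 0 ≤ h W) (hh1 : ∀ W, h W ≤ 1) (hgconj : ∀ a W : SU2, g (a * W * a⁻¹) = g W)
    (hhconj : ∀ a W : SU2, h (a * W * a⁻¹) = h W) (hgcen : ∀ z : SU2, z ∈ Subgroup.center SU2 → ∀ W, g (z * W) = g W)
    (hhcen : ∀ z : SU2, z ∈ Subgroup.center SU2 → ∀ W, h (z * W) = h W) : IsPhys (linkState g h) := by
  unfold linkState
  refine isPhys_linkProduct _ (fun e => ?_) (fun e W => ?_) (fun e W => ?_) (fun e a W => ?_) (fun e z hz W => ?_) <;>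
    rw [update_apply_eq] <;> split_ifs
  exacts [hhc, hgc, hh0 W, hg0 W, hh1 W, hg1 W, hhconj a W, hgconj a W, hhcen z hz W, hgcen z hz W]

/-- `0 ≤ linkState g h ≤ 1` for `[0,1]`-valued profiles: the bound. [folklore] -/
theorem abs_linkState_le {g h : SU2 → ℝ} (hg0 : ∀ W, 0 ≤ g W) (hg1 : ∀ W, g W ≤ 1) (hh0 : ∀ W, 0 ≤ h W) (hh1 : ∀ W, h W ≤ 1)
    (U : Cfg) : |linkState g h U| ≤ 1 := by
  unfold linkState
  rw [Finset.abs_prod]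
  calc ∏ e, |Function.update (fun _ : Edge 3 1 => g) e0 h e (U e)| ≤ ∏ _e : Edge 3 1, (1 : ℝ) :=
        Finset.prod_le_prod (fun e _ => abs_nonneg _) fun e _ => by
          rw [update_apply_eq]; split_ifs
          · rw [abs_of_nonneg (hh0 _)]; exact hh1 _
          · rw [abs_of_nonneg (hg0 _)]; exact hg1 _
    _ = 1 := by simp

/-- `0 ≤ linkState g h` for non-negative profiles. [folklore] -/
theorem linkState_nonneg {g h : SU2 → ℝ} (hg0 : ∀ W, 0 ≤ g W) (hh0 : ∀ W, 0 ≤ h W) (U : Cfg) : 0 ≤ linkState g h U := by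
  unfold linkState
  exact Finset.prod_nonneg fun e _ => by rw [update_apply_eq]; split_ifs <;> simp [hg0, hh0]

/-- If the product state is non-zero, every factor is. [folklore] -/
theorem factors_ne_zero_of_linkState_ne_zero {g h : SU2 → ℝ} {U : Cfg} (hU : linkState g h U ≠ 0) :
    h (U e0) ≠ 0 ∧ ∀ e, e ≠ e0 → g (U e) ≠ 0 := by
  unfold linkState at hU
  rw [Finset.prod_ne_zero_iff] at hU
  refine ⟨?_, fun e he => ?_⟩
  · have := hU e0 (Finset.mem_univ _); rwa [update_apply_eq, if_pos rfl] at this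
  · have := hU e (Finset.mem_univ _); rwa [update_apply_eq, if_neg he] at this

/-- **Electric form of product states**: `⟨g ⊗ h₁, E_B (g ⊗ h₂)⟩ = q_B(h₁,h₂) · q_B(g,g)^{|E|−1}`. [folklore] -/
theorem qE_linkState (B : ℝ) (g h₁ h₂ : SU2 → ℝ) :
    qE B (linkState g h₁) (linkState g h₂) = linkQ B h₁ h₂ * linkQ B g g ^ (Fintype.card (Edge 3 1) - 1) := by
  unfold linkState
  rw [qE_linkProduct, ← Finset.mul_prod_erase _ _ (Finset.mem_univ e0), update_apply_eq, update_apply_eq, if_pos rfl]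
  congr 1
  have hrest : ∀ e ∈ Finset.univ.erase e0, linkQ B (Function.update (fun _ : Edge 3 1 => g) e0 h₁ e)
      (Function.update (fun _ : Edge 3 1 => g) e0 h₂ e) = linkQ B g g := by
    intro e he
    rw [Finset.mem_erase] at he
    simp only [update_apply_eq, if_neg he.1]
  rw [Finset.prod_congr rfl hrest, Finset.prod_const, Finset.card_erase_of_mem (Finset.mem_univ _), Finset.card_univ]

/-- **`l2` of product states**: `⟨g ⊗ h₁, g ⊗ h₂⟩ = (∫ h₁ h₂) (∫ g²)^{|E|−1}`. [folklore] -/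
theorem l2_linkState (g h₁ h₂ : SU2 → ℝ) :
    l2 (linkState g h₁) (linkState g h₂) =
      (∫ u, h₁ u * h₂ u ∂haarProbability SU2) * (∫ u, g u * g u ∂haarProbability SU2) ^ (Fintype.card (Edge 3 1) - 1) := by
  unfold linkState
  rw [l2_linkProduct, ← Finset.mul_prod_erase _ _ (Finset.mem_univ e0), update_apply_eq, update_apply_eq, if_pos rfl]
  congr 1
  have hrest : ∀ e ∈ Finset.univ.erase e0, ∫ u, Function.update (fun _ : Edge 3 1 => g) e0 h₁ e u *
      Function.update (fun _ : Edge 3 1 => g) e0 h₂ e u ∂haarProbability SU2 = ∫ u, g u * g u ∂haarProbability SU2 := by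
    intro e he
    rw [Finset.mem_erase] at he
    simp only [update_apply_eq, if_neg he.1]
  rw [Finset.prod_congr rfl hrest, Finset.prod_const, Finset.card_erase_of_mem (Finset.mem_univ _), Finset.card_univ]

/-- The BALL state `a = ⊗ₑ g_a`. [folklore] -/
def stA (r : ℝ) : Cfg → ℝ := linkState (profA r) (profA r)

/-- The ANNULUS state `b = g_b ⊗ (⊗_{e ≠ e₀} g_a)`. [folklore] -/
def stB (r : ℝ) : Cfg → ℝ := linkState (profA r) (profB r)

/-- `a` is physical. [folklore] -/
theorem isPhys_stA (r : ℝ) : IsPhys (stA r) :=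
  isPhys_linkState (continuous_profA r) (continuous_profA r) (profA_nonneg r) (profA_le_one r) (profA_nonneg r) (profA_le_one r)
    (profA_conj r) (profA_conj r) (fun _ hz => profA_center r hz) (fun _ hz => profA_center r hz)

/-- `b` is physical. [folklore] -/
theorem isPhys_stB (r : ℝ) : IsPhys (stB r) :=
  isPhys_linkState (continuous_profA r) (continuous_profB r) (profA_nonneg r) (profA_le_one r) (profB_nonneg r) (profB_le_one r)
    (profA_conj r) (profB_conj r) (fun _ hz => profA_center r hz) (fun _ hz => profB_center r hz)

/-- `0 ≤ a`. [folklore] -/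
theorem stA_nonneg (r : ℝ) (U : Cfg) : 0 ≤ stA r U := linkState_nonneg (profA_nonneg r) (profA_nonneg r) U

/-- `0 ≤ b`. [folklore] -/
theorem stB_nonneg (r : ℝ) (U : Cfg) : 0 ≤ stB r U := linkState_nonneg (profA_nonneg r) (profB_nonneg r) U

/-- `|a| ≤ 1`. [folklore] -/
theorem abs_stA_le (r : ℝ) (U : Cfg) : |stA r U| ≤ 1 :=
  abs_linkState_le (profA_nonneg r) (profA_le_one r) (profA_nonneg r) (profA_le_one r) U

/-- `|b| ≤ 1`. [folklore] -/
theorem abs_stB_le (r : ℝ) (U : Cfg) : |stB r U| ≤ 1 :=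
  abs_linkState_le (profA_nonneg r) (profA_le_one r) (profB_nonneg r) (profB_le_one r) U

/-- `a b = 0` pointwise (disjoint supports on the link `e₀`). [folklore] -/
theorem stA_mul_stB {r : ℝ} (hr : 0 < r) (U : Cfg) : stA r U * stB r U = 0 := by
  by_cases ha : stA r U = 0
  · rw [ha, zero_mul]
  by_cases hb : stB r U = 0
  · rw [hb, mul_zero]
  exfalso
  have h1 := (factors_ne_zero_of_linkState_ne_zero ha).1
  have h2 := (factors_ne_zero_of_linkState_ne_zero hb).1
  have := profA_mul_profB hr (U e0)
  rcases mul_eq_zero.mp this with h | h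
  · exact h1 h
  · exact h2 h

/-- On the support of `a` every link is within vacuum-distance `3r`. [folklore] -/
theorem vacDist_le_of_stA_ne_zero {r : ℝ} (hr : 0 < r) {U : Cfg} (hU : stA r U ≠ 0) (e : Edge 3 1) : vacDist (U e) ≤ 3 * r := by
  obtain ⟨h0, h1⟩ := factors_ne_zero_of_linkState_ne_zero hU
  by_cases he : e = e0
  · subst he; linarith [vacDist_lt_of_profA_ne_zero hr h0]
  · linarith [vacDist_lt_of_profA_ne_zero hr (h1 e he)]

/-- On the support of `b` every link is within vacuum-distance `3r`. [folklore] -/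
theorem vacDist_le_of_stB_ne_zero {r : ℝ} (hr : 0 < r) {U : Cfg} (hU : stB r U ≠ 0) (e : Edge 3 1) : vacDist (U e) ≤ 3 * r := by
  obtain ⟨h0, h1⟩ := factors_ne_zero_of_linkState_ne_zero hU
  by_cases he : e = e0
  · subst he; exact le_of_lt (vacDist_of_profB_ne_zero hr h0).2
  · linarith [vacDist_lt_of_profA_ne_zero hr (h1 e he)]

/-- The magnetic energy bound on the support region: `s₀(r) = |P| · 2 (3r)⁴`. [folklore] -/
def s0 (r : ℝ) : ℝ := (Fintype.card (Plaquette 3 1) : ℝ) * (2 * (3 * r) ^ 2 * (3 * r) ^ 2)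

/-- `0 ≤ s₀(r)`. [folklore] -/
theorem s0_nonneg (r : ℝ) : 0 ≤ s0 r := by unfold s0; positivity

/-! ### D.4 The trial state and the kernel lower bound -/

/-- The trial state `ψ = q a − p b`. [folklore] -/
def trial (r p q : ℝ) : Cfg → ℝ := fun U => q * stA r U - p * stB r U

/-- `ψ` is physical. [folklore] -/
theorem isPhys_trial (r p q : ℝ) : IsPhys (trial r p q) := isPhys_lincomb (isPhys_stA r) (isPhys_stB r) q p

/-- **Pointwise kernel bound** for the trial state:
`ψ(U) K ψ(V) ≥ e^{−B s₀} (q² a(U)E a(V) + p² b(U)E b(V)) − |p||q| (a(U)E b(V) + b(U)E a(V))`. [folklore] -/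
theorem trial_pointwise {B r : ℝ} (hB : 0 ≤ B) (hr : 0 < r) (p q : ℝ) (U V : Cfg) :
    Real.exp (-(B * s0 r)) * (q ^ 2 * (stA r U * linkE B U V * stA r V) + p ^ 2 * (stB r U * linkE B U V * stB r V))
      - |p| * |q| * (stA r U * linkE B U V * stB r V + stB r U * linkE B U V * stA r V)
    ≤ trial r p q U * transferKernel su2Rep B U V * trial r p q V := by
  have hK := transferKernel_pos su2Rep B U V
  have hKE := transferKernel_le_linkE hB U V
  have hE := linkE_pos B U V
  have haU := stA_nonneg r U
  have haV := stA_nonneg r V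
  have hbU := stB_nonneg r U
  have hbV := stB_nonneg r V
  have hreg : ∀ {f g : Cfg → ℝ}, (∀ U, 0 ≤ f U) → (∀ U, 0 ≤ g U) →
      (∀ U, f U ≠ 0 → wilsonAction su2Rep U ≤ s0 r) → (∀ V, g V ≠ 0 → wilsonAction su2Rep V ≤ s0 r) →
      Real.exp (-(B * s0 r)) * (f U * linkE B U V * g V) ≤ f U * transferKernel su2Rep B U V * g V := by
    intro f g hf hg hfS hgS
    by_cases h0 : f U = 0 ∨ g V = 0
    · rcases h0 with h | h <;> simp [h]
    · push Not at h0
      have hlow := exp_mul_linkE_le_transferKernel hB (hfS U h0.1) (hgS V h0.2)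
      have := mul_le_mul_of_nonneg_left hlow (mul_nonneg (hf U) (hg V))
      nlinarith [this]
  have hSa : ∀ U, stA r U ≠ 0 → wilsonAction su2Rep U ≤ s0 r := fun U hU =>
    wilsonAction_le_of_vacDist U (vacDist_le_of_stA_ne_zero hr hU)
  have hSb : ∀ U, stB r U ≠ 0 → wilsonAction su2Rep U ≤ s0 r := fun U hU =>
    wilsonAction_le_of_vacDist U (vacDist_le_of_stB_ne_zero hr hU)
  have h1 := hreg (stA_nonneg r) (stA_nonneg r) hSa hSa
  have h2 := hreg (stB_nonneg r) (stB_nonneg r) hSb hSb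
  have Y0 : 0 ≤ stA r U * transferKernel su2Rep B U V * stB r V + stB r U * transferKernel su2Rep B U V * stA r V := by
    positivity
  have YE : stA r U * transferKernel su2Rep B U V * stB r V + stB r U * transferKernel su2Rep B U V * stA r V ≤
      stA r U * linkE B U V * stB r V + stB r U * linkE B U V * stA r V :=
    add_le_add (mul_le_mul_of_nonneg_right (mul_le_mul_of_nonneg_left hKE haU) hbV)
      (mul_le_mul_of_nonneg_right (mul_le_mul_of_nonneg_left hKE hbU) haV)
  have h3 : p * q * (stA r U * transferKernel su2Rep B U V * stB r V + stB r U * transferKernel su2Rep B U V * stA r V) ≤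
      |p| * |q| * (stA r U * linkE B U V * stB r V + stB r U * linkE B U V * stA r V) := by
    calc p * q * (stA r U * transferKernel su2Rep B U V * stB r V + stB r U * transferKernel su2Rep B U V * stA r V)
        ≤ |p * q| * (stA r U * transferKernel su2Rep B U V * stB r V + stB r U * transferKernel su2Rep B U V * stA r V) :=
          mul_le_mul_of_nonneg_right (le_abs_self _) Y0
      _ ≤ |p * q| * (stA r U * linkE B U V * stB r V + stB r U * linkE B U V * stA r V) :=
          mul_le_mul_of_nonneg_left YE (abs_nonneg _)
      _ = |p| * |q| * (stA r U * linkE B U V * stB r V + stB r U * linkE B U V * stA r V) := by rw [abs_mul]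
  have h1' := mul_le_mul_of_nonneg_left h1 (sq_nonneg q)
  have h2' := mul_le_mul_of_nonneg_left h2 (sq_nonneg p)
  have expand : trial r p q U * transferKernel su2Rep B U V * trial r p q V =
      q ^ 2 * (stA r U * transferKernel su2Rep B U V * stA r V) + p ^ 2 * (stB r U * transferKernel su2Rep B U V * stB r V)
        - p * q * (stA r U * transferKernel su2Rep B U V * stB r V + stB r U * transferKernel su2Rep B U V * stA r V) := by
    unfold trial; ring
  rw [expand]
  linarith

/-- **Integrated kernel bound**:
`⟨ψ, K_B ψ⟩ ≥ e^{−B s₀} (q² ⟨a,E a⟩ + p² ⟨b,E b⟩) − |p||q| (⟨a,E b⟩ + ⟨b,E a⟩)`. [folklore] -/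
theorem qform_trial_ge {B r : ℝ} (hB : 0 ≤ B) (hr : 0 < r) (p q : ℝ) :
    Real.exp (-(B * s0 r)) * (q ^ 2 * qE B (stA r) (stA r) + p ^ 2 * qE B (stB r) (stB r))
      - |p| * |q| * (qE B (stA r) (stB r) + qE B (stB r) (stA r))
    ≤ qform su2Rep B (trial r p q) (trial r p q) := by
  have ham := (isPhys_stA r).measurable
  have hbm := (isPhys_stB r).measurable
  have hab := abs_stA_le r
  have hbb := abs_stB_le r
  have hEm := measurable_linkE B
  have hEb : ∀ p : Cfg × Cfg, |linkE B p.1 p.2| ≤ Real.exp (2 * B) ^ Fintype.card (Edge 3 1) := fun p => abs_linkE_le hB p.1 p.2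
  have iaa := integrable_sandwich' hEm hEb ham ham hab hab
  have ibb := integrable_sandwich' hEm hEb hbm hbm hbb hbb
  have iab := integrable_sandwich' hEm hEb ham hbm hab hbb
  have iba := integrable_sandwich' hEm hEb hbm ham hbb hab
  rw [qE_eq_integral_prod hB ham ham hab hab, qE_eq_integral_prod hB hbm hbm hbb hbb, qE_eq_integral_prod hB ham hbm hab hbb,
    qE_eq_integral_prod hB hbm ham hbb hab, qform_eq_integral_cfgProd hB (isPhys_trial r p q)]
  set μ2 := (configMeasure SU2 1).prod (configMeasure SU2 1) with hμ2
  have i1 : Integrable (fun z : Cfg × Cfg => q ^ 2 * (stA r z.1 * linkE B z.1 z.2 * stA r z.2) +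
      p ^ 2 * (stB r z.1 * linkE B z.1 z.2 * stB r z.2)) μ2 := (iaa.const_mul _).add (ibb.const_mul _)
  have i2 : Integrable (fun z : Cfg × Cfg => stA r z.1 * linkE B z.1 z.2 * stB r z.2 + stB r z.1 * linkE B z.1 z.2 * stA r z.2) μ2 :=
    iab.add iba
  have i1' : Integrable (fun z : Cfg × Cfg => Real.exp (-(B * s0 r)) * (q ^ 2 * (stA r z.1 * linkE B z.1 z.2 * stA r z.2) +
      p ^ 2 * (stB r z.1 * linkE B z.1 z.2 * stB r z.2))) μ2 := i1.const_mul _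
  have i2' : Integrable (fun z : Cfg × Cfg => |p| * |q| * (stA r z.1 * linkE B z.1 z.2 * stB r z.2 +
      stB r z.1 * linkE B z.1 z.2 * stA r z.2)) μ2 := i2.const_mul _
  have e1 : ∫ z, q ^ 2 * (stA r z.1 * linkE B z.1 z.2 * stA r z.2) + p ^ 2 * (stB r z.1 * linkE B z.1 z.2 * stB r z.2) ∂μ2 =
      q ^ 2 * ∫ z, stA r z.1 * linkE B z.1 z.2 * stA r z.2 ∂μ2 + p ^ 2 * ∫ z, stB r z.1 * linkE B z.1 z.2 * stB r z.2 ∂μ2 := by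
    rw [integral_add (iaa.const_mul _) (ibb.const_mul _), integral_const_mul, integral_const_mul]
  have e2 : ∫ z, stA r z.1 * linkE B z.1 z.2 * stB r z.2 + stB r z.1 * linkE B z.1 z.2 * stA r z.2 ∂μ2 =
      (∫ z, stA r z.1 * linkE B z.1 z.2 * stB r z.2 ∂μ2) + ∫ z, stB r z.1 * linkE B z.1 z.2 * stA r z.2 ∂μ2 :=
    integral_add iab iba
  have etot : ∫ z, (Real.exp (-(B * s0 r)) * (q ^ 2 * (stA r z.1 * linkE B z.1 z.2 * stA r z.2) +
      p ^ 2 * (stB r z.1 * linkE B z.1 z.2 * stB r z.2)) -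
      |p| * |q| * (stA r z.1 * linkE B z.1 z.2 * stB r z.2 + stB r z.1 * linkE B z.1 z.2 * stA r z.2)) ∂μ2 =
      Real.exp (-(B * s0 r)) * (q ^ 2 * ∫ z, stA r z.1 * linkE B z.1 z.2 * stA r z.2 ∂μ2 +
        p ^ 2 * ∫ z, stB r z.1 * linkE B z.1 z.2 * stB r z.2 ∂μ2) -
      |p| * |q| * ((∫ z, stA r z.1 * linkE B z.1 z.2 * stB r z.2 ∂μ2) + ∫ z, stB r z.1 * linkE B z.1 z.2 * stA r z.2 ∂μ2) := by
    rw [integral_sub i1' i2', integral_const_mul, integral_const_mul, e1, e2]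
  rw [← etot]
  exact integral_mono (i1'.sub i2') (integrable_sandwich' (measurable_transferKernel_su2 B) (abs_transferKernel_le hB)
    (isPhys_trial r p q).measurable (isPhys_trial r p q).measurable
    (fun U => (abs_sub _ _).trans (add_le_add (by rw [abs_mul]; exact mul_le_mul_of_nonneg_left (hab U) (abs_nonneg q))
      (by rw [abs_mul]; exact mul_le_mul_of_nonneg_left (hbb U) (abs_nonneg p))))
    (fun U => (abs_sub _ _).trans (add_le_add (by rw [abs_mul]; exact mul_le_mul_of_nonneg_left (hab U) (abs_nonneg q))
      (by rw [abs_mul]; exact mul_le_mul_of_nonneg_left (hbb U) (abs_nonneg p)))))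
    fun z => trial_pointwise hB hr p q z.1 z.2

/-- `‖ψ‖² = q² ‖a‖² + p² ‖b‖²` (the supports of `a` and `b` are disjoint). [folklore] -/
theorem l2_trial {r : ℝ} (hr : 0 < r) (p q : ℝ) :
    l2 (trial r p q) (trial r p q) = q ^ 2 * l2 (stA r) (stA r) + p ^ 2 * l2 (stB r) (stB r) := by
  unfold l2
  have hpt : ∀ U : Cfg, trial r p q U * trial r p q U = q ^ 2 * (stA r U * stA r U) + p ^ 2 * (stB r U * stB r U) := by
    intro U
    have h := stA_mul_stB hr U
    unfold trial
    have e : (q * stA r U - p * stB r U) * (q * stA r U - p * stB r U) =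
        q ^ 2 * (stA r U * stA r U) + p ^ 2 * (stB r U * stB r U) - 2 * p * q * (stA r U * stB r U) := by ring
    rw [e, h]; ring
  simp_rw [hpt]
  have ia : Integrable (fun U => stA r U * stA r U) (configMeasure SU2 1) := by
    refine integrable_of_measurable_abs_le _ ((isPhys_stA r).measurable.mul (isPhys_stA r).measurable) (C := 1) fun U => ?_
    rw [abs_mul]; exact mul_le_one₀ (abs_stA_le r U) (abs_nonneg _) (abs_stA_le r U)
  have ib : Integrable (fun U => stB r U * stB r U) (configMeasure SU2 1) := by
    refine integrable_of_measurable_abs_le _ ((isPhys_stB r).measurable.mul (isPhys_stB r).measurable) (C := 1) fun U => ?_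
    rw [abs_mul]; exact mul_le_one₀ (abs_stB_le r U) (abs_nonneg _) (abs_stB_le r U)
  rw [integral_add (ia.const_mul _) (ib.const_mul _), integral_const_mul, integral_const_mul]

/-- `⟨ψ, φ⟩ = q ⟨a, φ⟩ − p ⟨b, φ⟩`. [folklore] -/
theorem l2_trial_left {r : ℝ} (p q : ℝ) {φ : Cfg → ℝ} (hφ : IsPhys φ) :
    l2 (trial r p q) φ = q * l2 (stA r) φ - p * l2 (stB r) φ :=
  l2_lincomb_left (isPhys_stA r) (isPhys_stB r) hφ q p

end Summit.QuantumFields.YangMills.Theorems.FemtoTransferGap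

end
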